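import Summits.Ventures.LatticeQCDFlow.Exactness.HeatBathSweepErgodic
import HarnessLib

/-!
# A Doeblin chain has exactly one invariant probability law; so does the heat-bath sweep

HONEST FRAMING: exact (Metropolis-corrected) sampling algorithms for lattice gauge theory;
figures of merit are autocorrelation/cost numbers at stated couplings and volumes; no
continuum-physics claim.

Venture `LatticeQCDFlow` (cell pub-lqcd), topic `Exactness`, FANOUT row 9 (eng-latcore, the
engine `latflow.core`).  NEW WORK of the cell: the uniqueness corollary of row 9's
`RefreshScan.lean` (`uniformlyErgodic_of_minorised`, the bridge to the tree's Doeblin theorem) and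
`HeatBathSweepErgodic.lean`, stated as theorems (the docstrings there say "the invariant law is
unique"; here it is proved).  Nothing is cited as a fact.  Printed counterpart, NAMED ONLY:
Meyn–Tweedie 1993 Thm 16.0.2 (uniform ergodicity ⇒ unique invariant probability).

## What is proved

* **`invariant_unique_of_minorised`** — if a Markov kernel `κ` satisfies `κ(a, ·) ≥ ε ν` from every
  state (`ε > 0`, `ν` a probability law), then any two invariant probability laws coincide
  (`|π'(A) − π(A)| ≤ (1 − ε)ᵗ → 0`).
* **`heatBathSweep_invariant_unique`** — for the single-site heat-bath scan over a list through
  every site with joint density `m ≤ p ≤ M` (`0 < m`, `M < ∞`): every invariant probability law IS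
  the Gibbs law `piGibbsLaw μ p`; `heatBathSweep_comp_invariant_unique` — the same for
  `η ∘ₖ K` with any exact Markov `η` (the engine's HB + OR composite sweep): exactness of each piece
  gives invariance of the Gibbs law, Doeblin gives that nothing else is invariant.

NOT CLAIMED: existence questions (the Gibbs law is exhibited, so existence is not an issue);
non-probability invariant measures.
-/

namespace Summit.Ventures.LatticeQCDFlow.Exactness

open MeasureTheory ProbabilityTheory Filter
open scoped ENNReal Topology

section Unique

variable {α : Type*} [MeasurableSpace α]

/-- **A Doeblin chain has at most one invariant probability law.** -/
theorem invariant_unique_of_minorised {κ : Kernel α α} [IsMarkovKernel κ] {ν : Measure α}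
    [IsProbabilityMeasure ν] {ε : ℝ≥0∞} (h : ∀ a, ε • ν ≤ κ a) (hε : 0 < ε) {π π' : Measure α}
    [IsProbabilityMeasure π] [IsProbabilityMeasure π'] (hπ : Kernel.Invariant κ π)
    (hπ' : Kernel.Invariant κ π') : π' = π := by
  -- `ε ≤ 1` and the real rate `r = 1 − ε ∈ [0, 1)`
  obtain ⟨a⟩ := nonempty_of_isProbabilityMeasure π
  have hε1 : ε ≤ 1 := by
    have h1 := Measure.le_iff.1 (h a) Set.univ MeasurableSet.univ
    rw [Measure.smul_apply, smul_eq_mul, measure_univ, measure_univ, mul_one] at h1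
    exact h1
  have hεtop : ε ≠ ∞ := ne_top_of_le_ne_top ENNReal.one_ne_top hε1
  have hr0 : 0 ≤ 1 - ε.toReal :=
    sub_nonneg.2 (ENNReal.toReal_le_of_le_ofReal zero_le_one (by simpa using hε1))
  have hr1 : 1 - ε.toReal < 1 := sub_lt_self _ (ENNReal.toReal_pos hε.ne' hεtop)
  -- started from `π'`, the chain stays at `π'`; Doeblin pulls it to `π`
  have hfix : ∀ t, (fun m : Measure α => m.bind κ)^[t] π' = π' := fun t =>
    Function.iterate_fixed (f := fun m : Measure α => m.bind κ) hπ'.def t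
  have hbound : ∀ (A : Set α) (t : ℕ), |π'.real A - π.real A| ≤ (1 - ε.toReal) ^ t := fun A t => by
    have hu := uniformlyErgodic_of_minorised h hπ π' t A
    rwa [hfix t] at hu
  have hzero : ∀ A : Set α, π'.real A = π.real A := fun A => by
    have hlim : Tendsto (fun t : ℕ => (1 - ε.toReal) ^ t) atTop (𝓝 0) :=
      tendsto_pow_atTop_nhds_zero_of_lt_one hr0 hr1
    have hle : |π'.real A - π.real A| ≤ 0 :=
      ge_of_tendsto' hlim fun t => hbound A t
    exact sub_eq_zero.1 (abs_nonpos_iff.1 hle)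
  ext A hA
  have hA' := hzero A
  rw [measureReal_def, measureReal_def, ENNReal.toReal_eq_toReal_iff' (measure_ne_top _ _) (measure_ne_top _ _)] at hA'
  exact hA'

end Unique

section HeatBath

variable {ι : Type*} [Fintype ι] [DecidableEq ι] {X : ι → Type*} [∀ i, MeasurableSpace (X i)]
variable {μ : Π i, Measure (X i)} [∀ i, IsProbabilityMeasure (μ i)] {p : (Π j, X j) → ℝ≥0∞}
variable {m M : ℝ≥0∞}

/-- **The Gibbs law is the ONLY invariant probability law of the heat-bath sweep** (scan through
every site, joint density `m ≤ p ≤ M`, `0 < m`, `M < ∞`). -/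
theorem heatBathSweep_invariant_unique (hp : Measurable p) (hm0 : m ≠ 0) (hMtop : M ≠ ∞)
    (hmp : ∀ ω, m ≤ p ω) (hpM : ∀ ω, p ω ≤ M) {l : List ι} (hl : ∀ i, i ∈ l)
    {π' : Measure (Π j, X j)} [IsProbabilityMeasure π']
    (hπ' : Kernel.Invariant (cycle (l.map (siteHeatBath μ p))) π') : π' = piGibbsLaw μ p := by
  haveI := isMarkovKernel_heatBathSweep (μ := μ) hp hm0 hMtop hmp hpM l
  haveI := isProbabilityMeasure_piGibbsLaw (μ := μ) (p := p) hm0 hMtop hmp hpM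
  have hε : 0 < (m * M⁻¹) ^ l.length :=
    pos_iff_ne_zero.2 (pow_ne_zero _ (mul_ne_zero hm0 (ENNReal.inv_ne_zero.2 hMtop)))
  exact invariant_unique_of_minorised (heatBathSweep_minorised (μ := μ) hp hm0 hMtop hmp hpM hl) hε
    (heatBathSweep_invariant_piGibbsLaw (μ := μ) hp hm0 hMtop hmp hpM l) hπ'

/-- **… and of the composite sweep** `η ∘ₖ K` for any Markov `η` leaving `p · ⊗μ_i` invariant
(heat-bath sweep followed by over-relaxation sweeps). -/
theorem heatBathSweep_comp_invariant_unique (hp : Measurable p) (hm0 : m ≠ 0) (hMtop : M ≠ ∞)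
    (hmp : ∀ ω, m ≤ p ω) (hpM : ∀ ω, p ω ≤ M) {l : List ι} (hl : ∀ i, i ∈ l)
    (η : Kernel (Π j, X j) (Π j, X j)) [IsMarkovKernel η]
    (hη : Kernel.Invariant η ((Measure.pi μ).withDensity p))
    {π' : Measure (Π j, X j)} [IsProbabilityMeasure π']
    (hπ' : Kernel.Invariant (η ∘ₖ cycle (l.map (siteHeatBath μ p))) π') : π' = piGibbsLaw μ p := by
  haveI : ∀ i, Nonempty (X i) := fun i => nonempty_of_isProbabilityMeasure (μ i)
  haveI := isMarkovKernel_heatBathSweep (μ := μ) hp hm0 hMtop hmp hpM l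
  haveI := isProbabilityMeasure_piGibbsLaw (μ := μ) (p := p) hm0 hMtop hmp hpM
  haveI : IsProbabilityMeasure ((Measure.pi μ).bind η) :=
    ⟨by rw [Measure.bind_apply MeasurableSet.univ (Kernel.aemeasurable _)]; simp⟩
  have hε : 0 < (m * M⁻¹) ^ l.length :=
    pos_iff_ne_zero.2 (pow_ne_zero _ (mul_ne_zero hm0 (ENNReal.inv_ne_zero.2 hMtop)))
  have hmin := fun a =>
    minorised_comp_left (heatBathSweep_minorised (μ := μ) hp hm0 hMtop hmp hpM hl) η a
  have hinv : Kernel.Invariant (η ∘ₖ cycle (l.map (siteHeatBath μ p))) (piGibbsLaw μ p) :=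
    (invariant_smul hη _).comp (heatBathSweep_invariant_piGibbsLaw (μ := μ) hp hm0 hMtop hmp hpM l)
  exact invariant_unique_of_minorised hmin hε hinv hπ'

end HeatBath

end Summit.Ventures.LatticeQCDFlow.Exactness
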